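import Summits.CriticalPhenomena.PercolationContinuityZ3.Theorems.SahiTP2Positivity

/-!
# Laws with an (aligned) log-supermodular density w.r.t. ANY product reference measure are TP₂ across cuts

Companion of `SahiTP2Kernel.lean` / `SahiTP2Positivity.lean` (cell `prim-sahi`, typer seat, generation 10;
`--supports stmt-CriticalPhenomena-4575`).

`SahiTwoDimDensity` (generation 5) and `SahiLiebSahiContinuumDensity` (generation 6) treat probability measures
`ρ · λ` with a (bounded, then unbounded) measurable log-supermodular density with respect to LEBESGUE measure.  Here
the reference measure is an arbitrary product `ν₁ ⊗ ν₂` of s-finite measures (atoms, singular marginals, discrete ×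
continuous mixtures …) and the density only needs the ALIGNED half of log-supermodularity,
`ρ(x,y') ρ(x',y) ≤ ρ(x,y) ρ(x',y')` for `x ≤ x'`, `y ≤ y'`:

* `IsTP2Cut.withDensity_prod` — such a law is TP₂ across cuts (Tonelli on the aligned rectangles
  `[a₁,b₁] × Lᶜ`, `[a₂,b₂] × L` and the pointwise inequality; no four-functions theorem is needed because the four
  sets are aligned);
* `msahiE_withDensity_prod_unitSquare_nonneg` (+ `_antitone`) — on `[0,1]²`: every probability measure
  `ρ · (ν₁ ⊗ ν₂)` with `ρ` measurable and aligned-log-supermodular is Sahi-positive of every order for all measurable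
  monotone families (`msahiE_nonneg_of_isTP2Cut_unitSquare`);
* `IsTP2Cut.prod` — product measures are TP₂ across cuts (equality), as the case `ρ ≡ 1`.

No sorries, no new axioms.
-/

noncomputable section

namespace Summit.CriticalPhenomena.PercolationContinuityZ3.Theorems.SahiTP2

open MeasureTheory ProbabilityTheory Set Filter Topology Function
open Literature.Combinatorics.Sahi2008
open scoped ENNReal unitInterval

/-! ## Densities with respect to a product reference measure -/

section Density

/-- Rectangle masses of `ρ · (ν₁ ⊗ ν₂)` as iterated integrals. [folklore] -/
theorem withDensity_prod_apply_prod {α β : Type*} [MeasurableSpace α] [MeasurableSpace β] (ν₁ : Measure α)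
    (ν₂ : Measure β) [SFinite ν₁] [SFinite ν₂] {ρ : α × β → ℝ≥0∞} (hρm : Measurable ρ) {s : Set α} {t : Set β}
    (hs : MeasurableSet s) (ht : MeasurableSet t) :
    (ν₁.prod ν₂).withDensity ρ (s ×ˢ t) = ∫⁻ x in s, ∫⁻ y in t, ρ (x, y) ∂ν₂ ∂ν₁ := by
  rw [withDensity_apply _ (hs.prod ht), ← Measure.prod_restrict, lintegral_prod _ hρm.aemeasurable]

variable {α β : Type*} [Preorder α] [TopologicalSpace α] [OrderClosedTopology α] [MeasurableSpace α]
  [OpensMeasurableSpace α] [LinearOrder β] [MeasurableSpace β]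

/-- **A law with an aligned-log-supermodular density w.r.t. a product reference measure is TP₂ across cuts.**
[this work] -/
theorem IsTP2Cut.withDensity_prod (ν₁ : Measure α) (ν₂ : Measure β) [SFinite ν₁] [SFinite ν₂]
    {ρ : α × β → ℝ≥0∞} (hρm : Measurable ρ)
    (hρ : ∀ ⦃x x' : α⦄, x ≤ x' → ∀ ⦃y y' : β⦄, y ≤ y' → ρ (x, y') * ρ (x', y) ≤ ρ (x, y) * ρ (x', y')) :
    IsTP2Cut ((ν₁.prod ν₂).withDensity ρ) := by
  intro a₁ b₁ a₂ b₂ hlt L hL hLm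
  rw [withDensity_prod_apply_prod ν₁ ν₂ hρm measurableSet_Icc hLm.compl,
    withDensity_prod_apply_prod ν₁ ν₂ hρm measurableSet_Icc hLm,
    withDensity_prod_apply_prod ν₁ ν₂ hρm measurableSet_Icc hLm,
    withDensity_prod_apply_prod ν₁ ν₂ hρm measurableSet_Icc hLm.compl]
  -- sections are measurable
  have hsec : ∀ (t : Set β), Measurable fun x => ∫⁻ y in t, ρ (x, y) ∂ν₂ := fun t =>
    hρm.lintegral_prod_right' (ν := ν₂.restrict t)
  have hfib : ∀ x : α, Measurable fun y => ρ (x, y) := fun x => hρm.comp measurable_prodMk_left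
  rw [← lintegral_lintegral_mul (hsec Lᶜ).aemeasurable (hsec L).aemeasurable,
    ← lintegral_lintegral_mul (hsec L).aemeasurable (hsec Lᶜ).aemeasurable]
  refine setLIntegral_mono' measurableSet_Icc fun x hx => setLIntegral_mono' measurableSet_Icc fun x' hx' => ?_
  have hxx' : x ≤ x' := hx.2.trans (hlt.le.trans hx'.1)
  show (∫⁻ y in Lᶜ, ρ (x, y) ∂ν₂) * (∫⁻ y in L, ρ (x', y) ∂ν₂) ≤
    (∫⁻ y in L, ρ (x, y) ∂ν₂) * (∫⁻ y in Lᶜ, ρ (x', y) ∂ν₂)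
  calc (∫⁻ y in Lᶜ, ρ (x, y) ∂ν₂) * (∫⁻ y in L, ρ (x', y) ∂ν₂)
      = ∫⁻ y' in Lᶜ, ∫⁻ y in L, ρ (x, y') * ρ (x', y) ∂ν₂ ∂ν₂ :=
        (lintegral_lintegral_mul (hfib x).aemeasurable (hfib x').aemeasurable).symm
    _ ≤ ∫⁻ y' in Lᶜ, ∫⁻ y in L, ρ (x', y') * ρ (x, y) ∂ν₂ ∂ν₂ := by
        refine setLIntegral_mono' hLm.compl fun y' hy' => setLIntegral_mono' hLm fun y hy => ?_
        have hyy' : y ≤ y' := le_of_not_gt fun h => hy' (hL h.le hy)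
        rw [mul_comm (ρ (x', y'))]
        exact hρ hxx' hyy'
    _ = (∫⁻ y' in Lᶜ, ρ (x', y') ∂ν₂) * (∫⁻ y in L, ρ (x, y) ∂ν₂) :=
        lintegral_lintegral_mul (hfib x').aemeasurable (hfib x).aemeasurable
    _ = (∫⁻ y in L, ρ (x, y) ∂ν₂) * (∫⁻ y in Lᶜ, ρ (x', y) ∂ν₂) := mul_comm _ _

omit [TopologicalSpace α] [OrderClosedTopology α] [OpensMeasurableSpace α] in
/-- **Product measures are TP₂ across cuts** (the case `ρ ≡ 1`: the two sides agree). [folklore] -/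
theorem IsTP2Cut.prod (ν₁ : Measure α) (ν₂ : Measure β) [SFinite ν₁] [SFinite ν₂] : IsTP2Cut (ν₁.prod ν₂) := by
  intro a₁ b₁ a₂ b₂ _ L _ hLm
  rw [Measure.prod_prod, Measure.prod_prod, Measure.prod_prod, Measure.prod_prod]
  exact le_of_eq (by ring)

end Density

/-! ## The unit square -/

/-- **Every probability measure on `[0,1]²` with an aligned-log-supermodular density w.r.t. a product reference
measure is Sahi-positive of every order**, for all measurable nonnegative monotone (increasing) families.  The reference
marginals `ν₁, ν₂` are arbitrary s-finite measures on `[0,1]` (atoms allowed) and the density need not be bounded.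
[this work] -/
theorem msahiE_withDensity_prod_unitSquare_nonneg (ν₁ ν₂ : Measure I) [SFinite ν₁] [SFinite ν₂]
    {ρ : I × I → ℝ≥0∞} (hρm : Measurable ρ)
    (hρ : ∀ ⦃x x' : I⦄, x ≤ x' → ∀ ⦃y y' : I⦄, y ≤ y' → ρ (x, y') * ρ (x', y) ≤ ρ (x, y) * ρ (x', y'))
    [IsProbabilityMeasure ((ν₁.prod ν₂).withDensity ρ)] (n : ℕ) (f : Fin n → I × I → ℝ)
    (hfm : ∀ i, Measurable (f i)) (hf0 : ∀ i p, 0 ≤ f i p) (hmono : ∀ i, Monotone (f i)) :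
    0 ≤ msahiE ((ν₁.prod ν₂).withDensity ρ) n f :=
  msahiE_nonneg_of_isTP2Cut_unitSquare _ (IsTP2Cut.withDensity_prod ν₁ ν₂ hρm hρ) n f hfm hf0 hmono

/-- The decreasing form of `msahiE_withDensity_prod_unitSquare_nonneg`. [this work] -/
theorem msahiE_withDensity_prod_unitSquare_nonneg_antitone (ν₁ ν₂ : Measure I) [SFinite ν₁] [SFinite ν₂]
    {ρ : I × I → ℝ≥0∞} (hρm : Measurable ρ)
    (hρ : ∀ ⦃x x' : I⦄, x ≤ x' → ∀ ⦃y y' : I⦄, y ≤ y' → ρ (x, y') * ρ (x', y) ≤ ρ (x, y) * ρ (x', y'))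
    [IsProbabilityMeasure ((ν₁.prod ν₂).withDensity ρ)] (n : ℕ) (f : Fin n → I × I → ℝ)
    (hfm : ∀ i, Measurable (f i)) (hf0 : ∀ i p, 0 ≤ f i p) (hanti : ∀ i, Antitone (f i)) :
    0 ≤ msahiE ((ν₁.prod ν₂).withDensity ρ) n f :=
  msahiE_nonneg_of_isTP2Cut_unitSquare_antitone _ (IsTP2Cut.withDensity_prod ν₁ ν₂ hρm hρ) n f hfm hf0 hanti

/-- Log-supermodularity in the lattice form `ρ(p) ρ(q) ≤ ρ(p ⊓ q) ρ(p ⊔ q)` implies the aligned form used above.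
[folklore] -/
theorem aligned_of_latticeCondition {α β : Type*} [LinearOrder α] [LinearOrder β] {ρ : α × β → ℝ≥0∞}
    (hρ : ∀ p q : α × β, ρ p * ρ q ≤ ρ (p ⊓ q) * ρ (p ⊔ q)) ⦃x x' : α⦄ (hxx' : x ≤ x') ⦃y y' : β⦄
    (hyy' : y ≤ y') : ρ (x, y') * ρ (x', y) ≤ ρ (x, y) * ρ (x', y') := by
  have h := hρ (x, y') (x', y)
  rwa [Prod.mk_inf_mk, Prod.mk_sup_mk, inf_of_le_left hxx', sup_of_le_right hxx', inf_of_le_right hyy',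
    sup_of_le_left hyy'] at h

end Summit.CriticalPhenomena.PercolationContinuityZ3.Theorems.SahiTP2
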